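import Literature.Geometry.Lorentzian.FutureCompleteImageFutureSet
import Literature.Geometry.Lorentzian.DataHypersurfaceLocalTrichotomy
import Literature.Geometry.Lorentzian.CauchyDevelopmentCausal
import HarnessLib

/-!
# A future-complete development contains the causal future of the data of any development it
# embeds into

Sequel to `FutureCompleteImageFutureSet.lean` (the image of a future timelike complete development
`𝒮₁` in a development `𝒮₂` of the same data is a future set containing `I⁺(ι₂ X)`). With the
horismos lemma `J⁺(ι X) ⊆ ι(X) ∪ I⁺(ι X)` for an acausal data hypersurface (O'Neill 1983, Ch. 14,
Lemma 14.42; `LorentzianMetric.causalFuture_subset_of_localTrichotomy` with the local trichotomy of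
`DataEmbedding.exists_nhds_subset_trichotomy_range`) this upgrades to the CAUSAL future:

* `DataEmbedding.chronologicalFuture_range_embed_subset'` — instance-free restatement of
  `DataEmbedding.chronologicalFuture_range_embed_subset`;
* `DataEmbedding.causalFuture_range_embed_subset` — for a time-orientation preserving isometric
  immersion `ψ : 𝒮₁ → 𝒮₂` with `ψ ∘ ι₁ = ι₂`, `𝒮₁` future timelike complete (its `exp` defined on
  the future timecone), `𝒮₂` causal (`IsCausallyWellBehaved`) with acausal data hypersurface:
  **`J⁺(ι₂ X) ⊆ ψ(M₁)`**;
* `CauchyDevelopment.causalFuture_range_embed_subset` — the same for Cauchy developments, where the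
  causality condition holds automatically (`CauchyDevelopment.isCausallyWellBehaved`); acausality of
  `ι₂(X)` is kept as the hypothesis `hac`, as in the tree's domain-of-dependence lemmas
  (`HypersurfaceShadowDomainCauchy`).

So, for the questions about the future of the data which the conjectures of summit
`FinalStateConjecture` ask of the MAXIMAL development (its clauses all live in `J⁺(ι X)`), a future
timelike geodesically complete development of the same data already carries the whole region in
question, isometrically. Everything is proved; no definitions and no named facts are introduced.

## References

* B. O'Neill, *Semi-Riemannian geometry with applications to relativity*, Academic Press 1983,
  Ch. 14, Lemma 14.42 (p. 425); Ch. 5, Lemma 5.33. Key `ONeillSemiRiemannian1983`.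
* J. K. Beem, P. E. Ehrlich, *Global Lorentzian Geometry*, Marcel Dekker 1981, Prop. 5.16 (3).
  Key `BeemEhrlich1981`.
-/

noncomputable section

open Set Function
open scoped Manifold ContDiff Topology

namespace Literature.Geometry.Lorentzian

open Literature.Geometry.Riemannian

universe u

variable {n : ℕ} {X : Type u} [TopologicalSpace X] [ChartedSpace (EuclideanSpace ℝ (Fin n)) X]
  [IsManifold (𝓡 n) ∞ X] [ConnectedSpace X] {D : InitialDataSet (𝓡 n) X}

namespace DataEmbedding

/-- **`I⁺(ι₂ X) ⊆ ψ(M₁)` for a future timelike complete `𝒮₁` mapped into `𝒮₂`** (instance-free form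
of `chronologicalFuture_range_embed_subset`: the Levi-Civita instances are discharged by
`PseudoRiemannianMetric.hasLeviCivita`). [cite: BeemEhrlich1981, Prop. 5.16 (3) (proof)] -/
theorem chronologicalFuture_range_embed_subset' {𝒮₁ 𝒮₂ : DataEmbedding D}
    {ψ : 𝒮₁.carrier → 𝒮₂.carrier}
    (hψ : 𝒮₁.metric.IsIsometricImmersion 𝒮₂.metric.toPseudoRiemannianMetric ψ)
    (hτ : 𝒮₁.timeOrientation.PreservesTimeOrientation ψ 𝒮₂.timeOrientation)
    (hι : ψ ∘ 𝒮₁.embed = 𝒮₂.embed)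
    (hc : ∀ [𝒮₁.metric.toPseudoRiemannianMetric.HasLeviCivita],
      ∀ (y : 𝒮₁.carrier) (w : TangentSpace (𝓡 (n + 1)) y), 𝒮₁.metric.IsTimelike w →
        𝒮₁.timeOrientation.IsFutureDirected w → w ∈ expDomain 𝒮₁.metric.leviCivita y) :
    𝒮₂.metric.chronologicalFuture 𝒮₂.timeOrientation (range 𝒮₂.embed) ⊆ range ψ := by
  haveI := 𝒮₂.metric.toPseudoRiemannianMetric.hasLeviCivita
  exact chronologicalFuture_range_embed_subset hψ hτ hι hc

/-- **A future timelike complete data embedding contains the CAUSAL future of the data of any causal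
data embedding with acausal data hypersurface it maps into: `J⁺(ι₂ X) ⊆ ψ(M₁)`** — from
`J⁺(ι₂ X) ⊆ ι₂(X) ∪ I⁺(ι₂ X)` (O'Neill 1983, Lemma 14.42, via the local trichotomy at the spacelike
data hypersurface) and the future-set property of `ψ(M₁) ⊇ ι₂(X)`.
[cite: ONeillSemiRiemannian1983, Ch. 14, Lemma 14.42 (p. 425)] -/
theorem causalFuture_range_embed_subset {𝒮₁ 𝒮₂ : DataEmbedding D} {ψ : 𝒮₁.carrier → 𝒮₂.carrier}
    (hψ : 𝒮₁.metric.IsIsometricImmersion 𝒮₂.metric.toPseudoRiemannianMetric ψ)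
    (hτ : 𝒮₁.timeOrientation.PreservesTimeOrientation ψ 𝒮₂.timeOrientation)
    (hι : ψ ∘ 𝒮₁.embed = 𝒮₂.embed)
    (hc : ∀ [𝒮₁.metric.toPseudoRiemannianMetric.HasLeviCivita],
      ∀ (y : 𝒮₁.carrier) (w : TangentSpace (𝓡 (n + 1)) y), 𝒮₁.metric.IsTimelike w →
        𝒮₁.timeOrientation.IsFutureDirected w → w ∈ expDomain 𝒮₁.metric.leviCivita y)
    (hcwb : 𝒮₂.metric.IsCausallyWellBehaved 𝒮₂.timeOrientation)
    (hac : ∀ p ∈ range 𝒮₂.embed, ∀ q ∈ range 𝒮₂.embed,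
      q ∈ 𝒮₂.metric.causalFuture 𝒮₂.timeOrientation {p} → q = p) :
    𝒮₂.metric.causalFuture 𝒮₂.timeOrientation (range 𝒮₂.embed) ⊆ range ψ := by
  have hn2 : (2 : ℕ∞ω) ≤ ∞ := WithTop.coe_le_coe.mpr le_top
  have hJ := LorentzianMetric.causalFuture_subset_of_localTrichotomy hn2 hcwb hac
    (fun u ↦ 𝒮₂.exists_nhds_subset_trichotomy_range u)
  have hsub : range 𝒮₂.embed ⊆ range ψ := by
    rw [← hι, range_comp]
    exact image_subset_range _ _
  intro x hx
  rcases hJ hx with hx | hx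
  · exact hsub hx
  · exact chronologicalFuture_range_embed_subset' hψ hτ hι hc hx

end DataEmbedding

namespace CauchyDevelopment

/-- **A future timelike complete Cauchy development contains the causal future of the data of any
Cauchy development of the same data it maps into** (acausal data hypersurface `ι₂(X)` assumed, as in
`HypersurfaceShadowDomainCauchy`; the causality condition of `𝒟₂` is automatic,
`CauchyDevelopment.isCausallyWellBehaved`): `J⁺(ι₂ X) ⊆ ψ(M₁)`. In particular this applies to the
embedding of a future-complete development into the maximal one: everything the maximal development
says about the causal future of the data is already visible, isometrically, in the future-complete
one. [cite: ONeillSemiRiemannian1983, Ch. 14, Lemma 14.42 (p. 425)] -/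
theorem causalFuture_range_embed_subset {𝒟₁ 𝒟₂ : CauchyDevelopment D}
    {ψ : 𝒟₁.carrier → 𝒟₂.carrier}
    (hψ : 𝒟₁.metric.IsIsometricImmersion 𝒟₂.metric.toPseudoRiemannianMetric ψ)
    (hτ : 𝒟₁.timeOrientation.PreservesTimeOrientation ψ 𝒟₂.timeOrientation)
    (hι : ψ ∘ 𝒟₁.embed = 𝒟₂.embed)
    (hc : ∀ [𝒟₁.metric.toPseudoRiemannianMetric.HasLeviCivita],
      ∀ (y : 𝒟₁.carrier) (w : TangentSpace (𝓡 (n + 1)) y), 𝒟₁.metric.IsTimelike w →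
        𝒟₁.timeOrientation.IsFutureDirected w → w ∈ expDomain 𝒟₁.metric.leviCivita y)
    (hac : ∀ p ∈ range 𝒟₂.embed, ∀ q ∈ range 𝒟₂.embed,
      q ∈ 𝒟₂.metric.causalFuture 𝒟₂.timeOrientation {p} → q = p) :
    𝒟₂.metric.causalFuture 𝒟₂.timeOrientation (range 𝒟₂.embed) ⊆ range ψ :=
  DataEmbedding.causalFuture_range_embed_subset (𝒮₁ := 𝒟₁.toDataEmbedding)
    (𝒮₂ := 𝒟₂.toDataEmbedding) hψ hτ hι hc 𝒟₂.isCausallyWellBehaved hac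

/-- **From `EmbedsInto`**: if `𝒟₁ ↪ 𝒟₂`, `𝒟₁` is future timelike complete and `ι₂(X)` is acausal,
the (unique) embedding covers `J⁺(ι₂ X)`. [cite: ONeillSemiRiemannian1983, Ch. 14, Lemma 14.42 (p. 425)] -/
theorem EmbedsInto.exists_causalFuture_range_embed_subset {𝒟₁ 𝒟₂ : CauchyDevelopment D}
    (h : 𝒟₁.EmbedsInto 𝒟₂)
    (hc : ∀ [𝒟₁.metric.toPseudoRiemannianMetric.HasLeviCivita],
      ∀ (y : 𝒟₁.carrier) (w : TangentSpace (𝓡 (n + 1)) y), 𝒟₁.metric.IsTimelike w →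
        𝒟₁.timeOrientation.IsFutureDirected w → w ∈ expDomain 𝒟₁.metric.leviCivita y)
    (hac : ∀ p ∈ range 𝒟₂.embed, ∀ q ∈ range 𝒟₂.embed,
      q ∈ 𝒟₂.metric.causalFuture 𝒟₂.timeOrientation {p} → q = p) :
    ∃ ψ : 𝒟₁.carrier → 𝒟₂.carrier,
      𝒟₁.metric.IsIsometricImmersion 𝒟₂.metric.toPseudoRiemannianMetric ψ ∧
        𝒟₁.timeOrientation.PreservesTimeOrientation ψ 𝒟₂.timeOrientation ∧ ψ ∘ 𝒟₁.embed = 𝒟₂.embed ∧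
          𝒟₂.metric.causalFuture 𝒟₂.timeOrientation (range 𝒟₂.embed) ⊆ range ψ := by
  obtain ⟨ψ, -, -, hψi, hψτ, hψι⟩ := h
  exact ⟨ψ, hψi, hψτ, hψι, causalFuture_range_embed_subset hψi hψτ hψι hc hac⟩

end CauchyDevelopment

end Literature.Geometry.Lorentzian

end
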